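import Summits.ResolutionOfSingularities.ResolutionOfSingularities.Theorems.EquisingularLiftEquisingularLiftNatSubchainPointResolutionOff
import Summits.ResolutionOfSingularities.ResolutionOfSingularities.Theorems.EquisingularLiftEquisingularLiftNatSubchainSupplierInvSLDefs
import Summits.ResolutionOfSingularities.ResolutionOfSingularities.Theorems.EquisingularLiftEquisingularLiftNatDirZeroDefs
import Summits.ResolutionOfSingularities.ResolutionOfSingularities.Theorems.EquisingularLiftEquisingularLiftNatResidueHypDefs10
import HarnessLib

/-!
# [OURS · L1 W4.5(b) · EL♮(3) · T-ISO ENGINE, supplier slots] THE SIX NAMED SUPPLIER SLOTS OF ✓ K5⁸ + THE SECTION-ROUND SLOT HROUND-SEC (W₂, desk R73/R73a)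

res-type-027 g23 (typing hand; design res-L1-w45b-stub-4 g15, option (B) of its K5⁹ plan: «named supplier slots so that
K5⁹ = K5⁸ + (HR-SEC) + (P-ram) fits the 400-line rule and every later K5ⁿ / RUNGⁿ reuses the slots»).  OURS = this programme's
bookkeeping vocabulary; not the statement of any manuscript ([Hironaka2017] is a candidate under adjudication, nothing of it is
asserted); AI-written, weaker than expert review.  PURE DEFINITIONS (`def … : Prop`), no theorem, no instance, no notation, no
`sorry`; `--supports stmt-ResolutionOfSingularities-20148 --as helper`.

CONTENT.  `HSub1Supplier k Reach`, `HSub2Supplier k n H ι ReachL LS`, `HPT6Supplier k`, `HOpenSupplier k n H ι Open`,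
`HPairSupplier k`, `HRoundKeepNSupplier k` are the six anonymous supplier hypotheses HSUB₁ / HSUB₂ / HPT⁶ / HOPEN / HPAIR /
HROUND-KEEP-N of ✓ `target_elnat_of_letteredPrefixResolution8` (`…NatLetteredPrefixResolution8` :58–:74, :76–:112, :115–:138,
:141–:168, :171–:190, :194–:248) COPIED BYTE-FOR-BYTE (outer parenthesis and trailing arrow removed; the ambient binders `k`, `n`,
`H`, `ι`, `Reach`, `ReachL`, `LS`, `Open` of K5⁸ become the parameters each slot actually mentions), so that K5⁸'s tree suppliers
inhabit them definitionally (e.g. `(TCPlus.hpt6_supplier k 3 : HPT6Supplier k)` up to `3 ↦ n`-instantiation by the caller).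
`HRoundSecSupplier k` (NEW, W₂ «SECTION ROUND», desk R73 (ii) / R73a (ii)) := `HRoundKeepNSupplier`'s text with the binder (N2)
«`Ẽ₁` regular along `Z̃`» (:220–:221) REPLACED by (L2) «at every closed point `z ∈ Z` the ideal of `Z` is the ideal of `Ē₁` plus ONE
element `f ∉ 𝓘(Ē₁)_z + 𝔪_z²`» (the (HR-SEC) letter of ✓/pending `…NatResidueHypDefs11`'s `PrefixReachKeyLetterParam9`, same
bytes in K5⁸'s spellings) and the binder (N4) (the `ψ`-section of `𝒩_{Z̃/Ẽ₁}`, :223–:231) DELETED; antecedents `E₁ ∈ Ls → Z ⊆ closure E₁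
→ Z ⊆ T₁ → ¬ T₁ ⊆ Z → (N1) → (L2) → DirStepUnobs → (N3) → members block → IsBlowup υ' 𝓘⟨Z⟩` and the OUTPUT (new model square,
every listed letter's strict transform carries its `LetterDatum`, the exceptional letter `υ'⁻¹ Z` is born) UNCHANGED.  Its intended
supplier (not here): ✓ `embeddedLiftFact_holds` (p704265) + nose-w1's (u2) «flat lift of a Cartier-by-parameter divisor is principal
and regular», composed like ✓ `TCPlus.hround_keep`. [folklore; K5⁸ (027 g22), K5⁶ (stub-2 g16), plan stub-4 g15 2026-08-29]
-/

set_option linter.dupNamespace false -- mandated namespace `Summit.<Summit>.<Problem>` of this single-conjunct summit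
set_option linter.overlappingInstances false -- signatures carry `[IsDomain O] [IsDiscreteValuationRing O]`
noncomputable section
open CategoryTheory CategoryTheory.Limits AlgebraicGeometry TopologicalSpace Topology MvPolynomial
open Literature.AlgebraicGeometry.Motives (projectiveSpace)
open Literature.AlgebraicGeometry.Resolution AlgebraicGeometry.Scheme.IdealSheafData
open Summit.ResolutionOfSingularities.ResolutionOfSingularities.Theses.EquisingularLift.Split
open Summit.ResolutionOfSingularities.ResolutionOfSingularities.Cruxes.EquisingularLift.StrataSplit

namespace Summit.ResolutionOfSingularities.ResolutionOfSingularities.Cruxes.EquisingularLiftNat.Sections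

/-- HSUB₁(`Reach`): K5′'s SUB-CHAIN SUPPLIER after a point step (letters dropped) — ✓ K5⁸ :58–:74 verbatim. [folklore; K5″/K5⁸] -/
def HSub1Supplier (k : Type) [Field k] (n : ℕ)
    (Reach : ∀ (F₁ F₂ : Scheme.{0}), (F₂ ⟶ F₁) → F₁ → Set F₂ → ∀ (F₉ : Scheme.{0}), (F₉ ⟶ F₂) → Set F₉ → Prop) : Prop :=
    ∀ (O : Type) [CommRing O] [IsDomain O] [IsDiscreteValuationRing O] [IsAdicComplete (IsLocalRing.maximalIdeal O) O] [IsAlgClosed (IsLocalRing.ResidueField O)] (θ : O →+* k), Function.Surjective θ →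
      ∀ (P : Scheme.{0}) (q : P ⟶ Spec (.of O)) (Y : Set P) (Ch : ∀ X' : Scheme.{0}, (X' ⟶ P) → Set X' → Prop), (∀ (X' X'' : Scheme.{0}) (σ' : X' ⟶ P) (S' : Set X') (C : X'.IdealSheafData) (τ : X'' ⟶ X'), Ch X' σ' S' → IsBlowup τ C →
          Scheme.IsRegular C.subscheme → Flat (C.subschemeι ≫ σ' ≫ q) → σ' '' (C.support : Set X') ⊆ {y | ¬ IsGenericPoint y Y} → (C.support : Set X') ∩ (σ' ≫ q) ⁻¹' {IsLocalRing.closedPoint O} ⊆ S' →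
          Ch X'' (τ ≫ σ') (closure (τ ⁻¹' (S' \ (C.support : Set X'))))) → (∀ (X' : Scheme.{0}) (σ' : X' ⟶ P) (S' : Set X'), Ch X' σ' S' → Chain P Y X' σ' S') → Y ⊆ q ⁻¹' {IsLocalRing.closedPoint O} → IsIrreducible Y → IsClosed Y →
        IsIntegral P → IsLocallyNoetherian P → Scheme.IsRegular P → IsProper q → SmoothOfRelativeDimension n q →
      -- the stage before the point step and its model
      ∀ (X' : Scheme.{0}) (σ' : X' ⟶ P) (S' : Set X'), Ch X' σ' S' → IsIntegral X' → IsLocallyNoetherian X' → Scheme.IsRegular X' → IsDominant (σ' ≫ q) → ∀ (F₁ : Scheme.{0}), IsIntegral F₁ → ∀ (j : F₁ ⟶ X') (t : F₁ ⟶ Spec (.of k)),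
        IsPullback j t (σ' ≫ q) (Spec.map (CommRingCat.ofHom θ)) → ∀ (T₁ : Set F₁), IsClosed T₁ → IsIrreducible T₁ → j '' T₁ = S' →
      -- the point step: section, its blow-up, the new stage and its model
      ∀ (x : F₁) (hx : IsClosed ({x} : Set F₁)) (U : X'.Opens), Smooth (U.ι ≫ σ' ≫ q) → ∀ (s : Spec (.of O) ⟶ X'), s ≫ σ' ≫ q = 𝟙 _ → s (IsLocalRing.closedPoint O) ∈ U → s (IsLocalRing.closedPoint O) = j x →
        ringKrullDim (X'.presheaf.stalk (s (IsLocalRing.closedPoint O))) = ((n + 1 : ℕ) : WithBot ℕ∞) → IsRegularLocalRing (F₁.presheaf.stalk x) → (∀ c ∈ (s.ker.support : Set X'), ¬ IsGenericPoint (σ' c) Y) →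
      ∀ (X₁ : Scheme.{0}) (τ₁ : X₁ ⟶ X'), IsBlowup τ₁ s.ker → IsIntegral X₁ → IsLocallyNoetherian X₁ → Scheme.IsRegular X₁ → IsDominant ((τ₁ ≫ σ') ≫ q) → ∀ (F₂ : Scheme.{0}), IsIntegral F₂ → ∀ (υ : F₂ ⟶ F₁), IsBlowup υ
          (vanishingIdeal (⟨{x}, hx⟩ : Closeds F₁)) → ∀ (j₂ : F₂ ⟶ X₁) (t₂ : F₂ ⟶ Spec (.of k)), IsPullback j₂ t₂ ((τ₁ ≫ σ') ≫ q) (Spec.map (CommRingCat.ofHom θ)) → j₂ ≫ τ₁ = υ ≫ j → (s.ker.comap τ₁).comap j₂ =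
          (vanishingIdeal (⟨{x}, hx⟩ : Closeds F₁)).comap υ → IsIrreducible (closure (υ ⁻¹' (T₁ \ {x}))) → Ch X₁ (τ₁ ≫ σ') (j₂ '' closure (υ ⁻¹' (T₁ \ {x}))) →
      -- the admissible downstairs sub-chains are matched upstairs
      ∀ (F₉ : Scheme.{0}) (β : F₉ ⟶ F₂) (T₉ : Set F₉), Reach F₁ F₂ υ x (closure (υ ⁻¹' (T₁ \ {x}))) F₉ β T₉ → ∃ (X₉ : Scheme.{0}) (σ₉ : X₉ ⟶ P) (S₉ : Set X₉) (j₉ : F₉ ⟶ X₉) (t₉ : F₉ ⟶ Spec (.of k)),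
          Ch X₉ σ₉ S₉ ∧ IsIntegral X₉ ∧ IsLocallyNoetherian X₉ ∧ Scheme.IsRegular X₉ ∧ IsDominant (σ₉ ≫ q) ∧ IsPullback j₉ t₉ (σ₉ ≫ q) (Spec.map (CommRingCat.ofHom θ)) ∧ j₉ '' T₉ = S₉ ∧ IsClosed T₉ ∧ IsIrreducible T₉ ∧ IsIntegral F₉

/-- HSUB₂(`ReachL`, `LS`): the INITIAL-STAGE LETTERED sub-chain supplier at `(ℙⁿ_O, 𝟙, Y)` with model `ℙⁿ_k` — ✓ K5⁸ :76–:112 verbatim. [folklore; K5″/K5⁸] -/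
def HSub2Supplier (k : Type) [Field k] (n : ℕ) (H : Scheme.{0}) (ι : H ⟶ (projectiveSpace n k).left)
    (ReachL : ∀ (F₂ : Scheme.{0}), (F₂ ⟶ (projectiveSpace n k).left) → (projectiveSpace n k).left → Set F₂ → List (Set F₂) →
      ∀ (F₉ : Scheme.{0}), (F₉ ⟶ F₂) → Set F₉ → Prop)
    (LS : ∀ (F₂ : Scheme.{0}), (F₂ ⟶ (projectiveSpace n k).left) → (projectiveSpace n k).left → List (Set F₂) → Prop) : Prop :=
    ∀ (O : Type) [CommRing O] [IsDomain O] [IsDiscreteValuationRing O] [IsAdicComplete (IsLocalRing.maximalIdeal O) O]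
        [IsAlgClosed (IsLocalRing.ResidueField O)] (θ : O →+* k), Function.Surjective θ → (letI := MvPolynomial.gradedAlgebra (σ := Fin (n + 1)) (R := O);
       letI := MvPolynomial.gradedAlgebra (σ := Fin (n + 1)) (R := k); ∀ (φ : homogeneousSubmodule (Fin (n + 1)) O →+*ᵍ homogeneousSubmodule (Fin (n + 1)) k)
        (hφ' : HomogeneousIdeal.irrelevant (homogeneousSubmodule (Fin (n + 1)) k) ≤ (HomogeneousIdeal.irrelevant (homogeneousSubmodule (Fin (n + 1)) O)).map φ),
        (∀ s, φ s = MvPolynomial.map θ s) → ∀ (Ch : ∀ X' : Scheme.{0}, (X' ⟶ (Proj (homogeneousSubmodule (Fin (n + 1)) O))) → Set X' → Prop),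
        (∀ (X' X'' : Scheme.{0}) (σ' : X' ⟶ (Proj (homogeneousSubmodule (Fin (n + 1)) O))) (S' : Set X') (C : X'.IdealSheafData) (τ : X'' ⟶ X'), Ch X' σ' S' → IsBlowup τ C →
          Scheme.IsRegular C.subscheme → Flat (C.subschemeι ≫ σ' ≫ (Proj.toSpecZero (homogeneousSubmodule (Fin (n + 1)) O) ≫ Spec.map (CommRingCat.ofHom (algebraMap O (homogeneousSubmodule (Fin (n + 1)) O 0))))) →
          σ' '' (C.support : Set X') ⊆ {y | ¬ IsGenericPoint y (Set.range (ι ≫ Proj.map φ hφ' : H ⟶ Proj (homogeneousSubmodule (Fin (n + 1)) O)))} →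
          (C.support : Set X') ∩ (σ' ≫ (Proj.toSpecZero (homogeneousSubmodule (Fin (n + 1)) O) ≫ Spec.map (CommRingCat.ofHom (algebraMap O (homogeneousSubmodule (Fin (n + 1)) O 0))))) ⁻¹' {IsLocalRing.closedPoint O} ⊆ S' →
          Ch X'' (τ ≫ σ') (closure (τ ⁻¹' (S' \ (C.support : Set X'))))) → (∀ (X' : Scheme.{0}) (σ' : X' ⟶ (Proj (homogeneousSubmodule (Fin (n + 1)) O))) (S' : Set X'), Ch X' σ' S' →
          Chain (Proj (homogeneousSubmodule (Fin (n + 1)) O)) (Set.range (ι ≫ Proj.map φ hφ' : H ⟶ Proj (homogeneousSubmodule (Fin (n + 1)) O))) X' σ' S') →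
        (Set.range (ι ≫ Proj.map φ hφ' : H ⟶ Proj (homogeneousSubmodule (Fin (n + 1)) O))) ⊆ (Proj.toSpecZero (homogeneousSubmodule (Fin (n + 1)) O) ≫ Spec.map (CommRingCat.ofHom (algebraMap O (homogeneousSubmodule (Fin (n + 1)) O 0)))) ⁻¹' {IsLocalRing.closedPoint O} → IsIrreducible (Set.range (ι ≫ Proj.map φ hφ' : H ⟶ Proj (homogeneousSubmodule (Fin (n + 1)) O))) → IsClosed (Set.range (ι ≫ Proj.map φ hφ' : H ⟶ Proj (homogeneousSubmodule (Fin (n + 1)) O))) →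
        IsIntegral (Proj (homogeneousSubmodule (Fin (n + 1)) O)) → IsLocallyNoetherian (Proj (homogeneousSubmodule (Fin (n + 1)) O)) → Scheme.IsRegular (Proj (homogeneousSubmodule (Fin (n + 1)) O)) →
        IsProper (Proj.toSpecZero (homogeneousSubmodule (Fin (n + 1)) O) ≫ Spec.map (CommRingCat.ofHom (algebraMap O (homogeneousSubmodule (Fin (n + 1)) O 0)))) → SmoothOfRelativeDimension n (Proj.toSpecZero (homogeneousSubmodule (Fin (n + 1)) O) ≫ Spec.map (CommRingCat.ofHom (algebraMap O (homogeneousSubmodule (Fin (n + 1)) O 0)))) →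
      -- the INITIAL stage `(ℙⁿ_O, 𝟙, Y)` and its model `ℙⁿ_k` (the base model square `Proj.map φ`)
      Ch (Proj (homogeneousSubmodule (Fin (n + 1)) O)) (𝟙 (Proj (homogeneousSubmodule (Fin (n + 1)) O))) (Set.range (ι ≫ Proj.map φ hφ' : H ⟶ Proj (homogeneousSubmodule (Fin (n + 1)) O))) → IsDominant (𝟙 (Proj (homogeneousSubmodule (Fin (n + 1)) O)) ≫ (Proj.toSpecZero (homogeneousSubmodule (Fin (n + 1)) O) ≫ Spec.map (CommRingCat.ofHom (algebraMap O (homogeneousSubmodule (Fin (n + 1)) O 0))))) →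
      IsIntegral (projectiveSpace n k).left → ∀ (t : (projectiveSpace n k).left ⟶ Spec (.of k)),
        IsPullback (Proj.map φ hφ' : (projectiveSpace n k).left ⟶ Proj (homogeneousSubmodule (Fin (n + 1)) O)) t (𝟙 (Proj (homogeneousSubmodule (Fin (n + 1)) O)) ≫ (Proj.toSpecZero (homogeneousSubmodule (Fin (n + 1)) O) ≫ Spec.map (CommRingCat.ofHom (algebraMap O (homogeneousSubmodule (Fin (n + 1)) O 0))))) (Spec.map (CommRingCat.ofHom θ)) →
      IsClosed (Set.range ι) → IsIrreducible (Set.range ι) → (Proj.map φ hφ' : (projectiveSpace n k).left ⟶ Proj (homogeneousSubmodule (Fin (n + 1)) O)) '' Set.range ι = (Set.range (ι ≫ Proj.map φ hφ' : H ⟶ Proj (homogeneousSubmodule (Fin (n + 1)) O))) →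
      -- the point step: section, its blow-up, the new stage and its model
      ∀ (x : (projectiveSpace n k).left) (hx : IsClosed ({x} : Set (projectiveSpace n k).left)) (U : (Proj (homogeneousSubmodule (Fin (n + 1)) O)).Opens), Smooth (U.ι ≫ 𝟙 (Proj (homogeneousSubmodule (Fin (n + 1)) O)) ≫ (Proj.toSpecZero (homogeneousSubmodule (Fin (n + 1)) O) ≫ Spec.map (CommRingCat.ofHom (algebraMap O (homogeneousSubmodule (Fin (n + 1)) O 0))))) →
      ∀ (s : Spec (.of O) ⟶ (Proj (homogeneousSubmodule (Fin (n + 1)) O))), s ≫ 𝟙 (Proj (homogeneousSubmodule (Fin (n + 1)) O)) ≫ (Proj.toSpecZero (homogeneousSubmodule (Fin (n + 1)) O) ≫ Spec.map (CommRingCat.ofHom (algebraMap O (homogeneousSubmodule (Fin (n + 1)) O 0)))) = 𝟙 _ → s (IsLocalRing.closedPoint O) ∈ U →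
        s (IsLocalRing.closedPoint O) = (Proj.map φ hφ' : (projectiveSpace n k).left ⟶ Proj (homogeneousSubmodule (Fin (n + 1)) O)) x →
        ringKrullDim ((Proj (homogeneousSubmodule (Fin (n + 1)) O)).presheaf.stalk (s (IsLocalRing.closedPoint O))) = ((n + 1 : ℕ) : WithBot ℕ∞) → IsRegularLocalRing ((projectiveSpace n k).left.presheaf.stalk x) →
        (∀ c ∈ (s.ker.support : Set (Proj (homogeneousSubmodule (Fin (n + 1)) O))), ¬ IsGenericPoint ((𝟙 (Proj (homogeneousSubmodule (Fin (n + 1)) O)) : (Proj (homogeneousSubmodule (Fin (n + 1)) O)) ⟶ (Proj (homogeneousSubmodule (Fin (n + 1)) O))) c) (Set.range (ι ≫ Proj.map φ hφ' : H ⟶ Proj (homogeneousSubmodule (Fin (n + 1)) O)))) →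
      ∀ (X₁ : Scheme.{0}) (τ₁ : X₁ ⟶ (Proj (homogeneousSubmodule (Fin (n + 1)) O))), IsBlowup τ₁ s.ker → IsIntegral X₁ → IsLocallyNoetherian X₁ → Scheme.IsRegular X₁ →
        IsDominant ((τ₁ ≫ 𝟙 (Proj (homogeneousSubmodule (Fin (n + 1)) O))) ≫ (Proj.toSpecZero (homogeneousSubmodule (Fin (n + 1)) O) ≫ Spec.map (CommRingCat.ofHom (algebraMap O (homogeneousSubmodule (Fin (n + 1)) O 0))))) →
      ∀ (F₂ : Scheme.{0}), IsIntegral F₂ → ∀ (υ : F₂ ⟶ (projectiveSpace n k).left), IsBlowup υ (vanishingIdeal (⟨{x}, hx⟩ : Closeds (projectiveSpace n k).left)) → ∀ (j₂ : F₂ ⟶ X₁) (t₂ : F₂ ⟶ Spec (.of k)),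
        IsPullback j₂ t₂ ((τ₁ ≫ 𝟙 (Proj (homogeneousSubmodule (Fin (n + 1)) O))) ≫ (Proj.toSpecZero (homogeneousSubmodule (Fin (n + 1)) O) ≫ Spec.map (CommRingCat.ofHom (algebraMap O (homogeneousSubmodule (Fin (n + 1)) O 0))))) (Spec.map (CommRingCat.ofHom θ)) → j₂ ≫ τ₁ = υ ≫ (Proj.map φ hφ' : (projectiveSpace n k).left ⟶ Proj (homogeneousSubmodule (Fin (n + 1)) O)) →
        (s.ker.comap τ₁).comap j₂ = (vanishingIdeal (⟨{x}, hx⟩ : Closeds (projectiveSpace n k).left)).comap υ → IsIrreducible (closure (υ ⁻¹' (Set.range ι \ {x}))) →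
        Ch X₁ (τ₁ ≫ 𝟙 (Proj (homogeneousSubmodule (Fin (n + 1)) O))) (j₂ '' closure (υ ⁻¹' (Set.range ι \ {x}))) →
      -- the LETTERS and the admissible lettered downstairs sub-chains, matched upstairs
      ∀ (Ls₂ : List (Set F₂)), LS F₂ υ x Ls₂ → ∀ (F₉ : Scheme.{0}) (β : F₉ ⟶ F₂) (T₉ : Set F₉), ReachL F₂ υ x (closure (υ ⁻¹' (Set.range ι \ {x}))) Ls₂ F₉ β T₉ →
        ∃ (X₉ : Scheme.{0}) (σ₉ : X₉ ⟶ (Proj (homogeneousSubmodule (Fin (n + 1)) O))) (S₉ : Set X₉) (j₉ : F₉ ⟶ X₉) (t₉ : F₉ ⟶ Spec (.of k)), Ch X₉ σ₉ S₉ ∧ IsIntegral X₉ ∧ IsLocallyNoetherian X₉ ∧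
          Scheme.IsRegular X₉ ∧ IsDominant (σ₉ ≫ (Proj.toSpecZero (homogeneousSubmodule (Fin (n + 1)) O) ≫ Spec.map (CommRingCat.ofHom (algebraMap O (homogeneousSubmodule (Fin (n + 1)) O 0))))) ∧
          IsPullback j₉ t₉ (σ₉ ≫ (Proj.toSpecZero (homogeneousSubmodule (Fin (n + 1)) O) ≫ Spec.map (CommRingCat.ofHom (algebraMap O (homogeneousSubmodule (Fin (n + 1)) O 0))))) (Spec.map (CommRingCat.ofHom θ)) ∧ j₉ '' T₉ = S₉ ∧
          IsClosed T₉ ∧ IsIrreducible T₉ ∧ IsIntegral F₉)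

/-- HPT⁶: the LETTERED POINT-STEP supplier (≤ 1 listed letter through the point, the others and the tag away, birth of `υ⁻¹{{x}}`) — ✓ K5⁸ :115–:138 verbatim. [folklore; K5⁶/K5⁸] -/
def HPT6Supplier (k : Type) [Field k] (n : ℕ) : Prop :=
  ∀ (O : Type) [CommRing O] [IsDomain O] [IsDiscreteValuationRing O] [IsAdicComplete (IsLocalRing.maximalIdeal O) O] [IsAlgClosed (IsLocalRing.ResidueField O)] (θ : O →+* k), Function.Surjective θ →
      ∀ (P : Scheme.{0}) (q : P ⟶ Spec (.of O)) (Y : Set P) (Ch : ∀ X' : Scheme.{0}, (X' ⟶ P) → Set X' → Prop), (∀ (X' X'' : Scheme.{0}) (σ' : X' ⟶ P) (S' : Set X') (C : X'.IdealSheafData) (τ : X'' ⟶ X'), Ch X' σ' S' → IsBlowup τ C →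
          Scheme.IsRegular C.subscheme → Flat (C.subschemeι ≫ σ' ≫ q) → σ' '' (C.support : Set X') ⊆ {y | ¬ IsGenericPoint y Y} → (C.support : Set X') ∩ (σ' ≫ q) ⁻¹' {IsLocalRing.closedPoint O} ⊆ S' →
          Ch X'' (τ ≫ σ') (closure (τ ⁻¹' (S' \ (C.support : Set X'))))) → (∀ (X' : Scheme.{0}) (σ' : X' ⟶ P) (S' : Set X'), Ch X' σ' S' → Chain P Y X' σ' S') → Y ⊆ q ⁻¹' {IsLocalRing.closedPoint O} → IsIrreducible Y → IsClosed Y →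
        IsIntegral P → IsLocallyNoetherian P → Scheme.IsRegular P → IsProper q → SmoothOfRelativeDimension n q →
      -- the stage and its model
      ∀ (X' : Scheme.{0}) (σ' : X' ⟶ P) (S' : Set X'), Ch X' σ' S' → IsIntegral X' → IsLocallyNoetherian X' → Scheme.IsRegular X' → IsDominant (σ' ≫ q) → ∀ (F₁ : Scheme.{0}), IsIntegral F₁ → ∀ (j : F₁ ⟶ X') (t : F₁ ⟶ Spec (.of k)),
        IsPullback j t (σ' ≫ q) (Spec.map (CommRingCat.ofHom θ)) → ∀ (T₁ : Set F₁), IsClosed T₁ → IsIrreducible T₁ → j '' T₁ = S' → ∀ (Ls : List (Set F₁)) (Kp : Option (Set F₁ × Set F₁ × Set F₁)), (∀ L ∈ Ls, TCPlus.LetterDatum O P q Y F₁ X' σ' j L) →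
        (∀ K A C : Set F₁, Kp = some (K, A, C) → (∃ (𝓚 𝓐 𝓒 : X'.IdealSheafData), (𝓚.comap j = vanishingIdeal (⟨closure K, isClosed_closure⟩ : Closeds F₁) ∧ (∀ z : X', (stalkIdeal 𝓚 z).IsPrincipal) ∧ Scheme.IsRegular 𝓚.subscheme ∧ σ' '' (𝓚.support : Set X') ⊆ {y : ↥P | ¬ IsGenericPoint y Y} ∧ Flat (𝓚.subschemeι ≫ σ' ≫ q)) ∧
            (𝓐.comap j = vanishingIdeal (⟨closure A, isClosed_closure⟩ : Closeds F₁) ∧ (∀ z : X', (stalkIdeal 𝓐 z).IsPrincipal) ∧ Scheme.IsRegular 𝓐.subscheme ∧ σ' '' (𝓐.support : Set X') ⊆ {y : ↥P | ¬ IsGenericPoint y Y} ∧ Flat (𝓐.subschemeι ≫ σ' ≫ q)) ∧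
            (𝓒.comap j = vanishingIdeal (⟨closure C, isClosed_closure⟩ : Closeds F₁) ∧ (∀ z : X', (stalkIdeal 𝓒 z).IsPrincipal) ∧ Scheme.IsRegular 𝓒.subscheme ∧ σ' '' (𝓒.support : Set X') ⊆ {y : ↥P | ¬ IsGenericPoint y Y} ∧ Flat (𝓒.subschemeι ≫ σ' ≫ q)) ∧ 𝓚 ≤ 𝓐 ⊔ 𝓒)) →
      ∀ (Lt : Option (Set F₁)) (x : ↥(vanishingIdeal (⟨closure T₁, isClosed_closure⟩ : Closeds F₁)).subscheme) (hx : IsClosed ({((vanishingIdeal (⟨closure T₁, isClosed_closure⟩ : Closeds F₁)).subschemeι x : F₁)} : Set F₁)),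
        ¬ IsRegularLocalRing ((vanishingIdeal (⟨closure T₁, isClosed_closure⟩ : Closeds F₁)).subscheme.presheaf.stalk x) → IsRegularLocalRing (F₁.presheaf.stalk ((vanishingIdeal (⟨closure T₁, isClosed_closure⟩ : Closeds F₁)).subschemeι x : F₁)) →
        (∀ L ∈ Ls, ((vanishingIdeal (⟨closure T₁, isClosed_closure⟩ : Closeds F₁)).subschemeι x : F₁) ∈ closure L → Lt = some L) →
        (∀ L : Set F₁, Lt = some L → L ∈ Ls ∧ ∀ e : ↥(redSub F₁ (closure L) isClosed_closure), (redSubι F₁ (closure L) isClosed_closure e : F₁) = ((vanishingIdeal (⟨closure T₁, isClosed_closure⟩ : Closeds F₁)).subschemeι x : F₁) →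
          IsRegularLocalRing ((redSub F₁ (closure L) isClosed_closure).presheaf.stalk e)) →
        (∀ K A C : Set F₁, Kp = some (K, A, C) → ((vanishingIdeal (⟨closure T₁, isClosed_closure⟩ : Closeds F₁)).subschemeι x : F₁) ∉ closure K ∧ ((vanishingIdeal (⟨closure T₁, isClosed_closure⟩ : Closeds F₁)).subschemeι x : F₁) ∉ closure A ∧ ((vanishingIdeal (⟨closure T₁, isClosed_closure⟩ : Closeds F₁)).subschemeι x : F₁) ∉ closure C) →
      ∀ (F₂ : Scheme.{0}) (υ : F₂ ⟶ F₁), IsBlowup υ (vanishingIdeal (⟨{((vanishingIdeal (⟨closure T₁, isClosed_closure⟩ : Closeds F₁)).subschemeι x : F₁)}, hx⟩ : Closeds F₁)) →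
        ∃ (X₉ : Scheme.{0}) (σ₉ : X₉ ⟶ P) (S₉ : Set X₉) (j₉ : F₂ ⟶ X₉) (t₉ : F₂ ⟶ Spec (.of k)), Ch X₉ σ₉ S₉ ∧ IsIntegral X₉ ∧ IsLocallyNoetherian X₉ ∧ Scheme.IsRegular X₉ ∧ IsDominant (σ₉ ≫ q) ∧
          IsPullback j₉ t₉ (σ₉ ≫ q) (Spec.map (CommRingCat.ofHom θ)) ∧ j₉ '' (closure (υ ⁻¹' (T₁ \ {((vanishingIdeal (⟨closure T₁, isClosed_closure⟩ : Closeds F₁)).subschemeι x : F₁)}))) = S₉ ∧ IsClosed (closure (υ ⁻¹' (T₁ \ {((vanishingIdeal (⟨closure T₁, isClosed_closure⟩ : Closeds F₁)).subschemeι x : F₁)}))) ∧ IsIrreducible (closure (υ ⁻¹' (T₁ \ {((vanishingIdeal (⟨closure T₁, isClosed_closure⟩ : Closeds F₁)).subschemeι x : F₁)}))) ∧ IsIntegral F₂ ∧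
          (∀ L ∈ Ls, TCPlus.LetterDatum O P q Y F₂ X₉ σ₉ j₉ (closure (υ ⁻¹' (L \ {((vanishingIdeal (⟨closure T₁, isClosed_closure⟩ : Closeds F₁)).subschemeι x : F₁)})))) ∧ TCPlus.LetterDatum O P q Y F₂ X₉ σ₉ j₉ (υ ⁻¹' {((vanishingIdeal (⟨closure T₁, isClosed_closure⟩ : Closeds F₁)).subschemeι x : F₁)}) ∧
          (∀ K A C : Set F₁, Kp = some (K, A, C) → (∃ (𝓚 𝓐 𝓒 : X₉.IdealSheafData), (𝓚.comap j₉ = vanishingIdeal (⟨closure (closure (υ ⁻¹' (K \ {((vanishingIdeal (⟨closure T₁, isClosed_closure⟩ : Closeds F₁)).subschemeι x : F₁)}))), isClosed_closure⟩ : Closeds F₂) ∧ (∀ z : X₉, (stalkIdeal 𝓚 z).IsPrincipal) ∧ Scheme.IsRegular 𝓚.subscheme ∧ σ₉ '' (𝓚.support : Set X₉) ⊆ {y : ↥P | ¬ IsGenericPoint y Y} ∧ Flat (𝓚.subschemeι ≫ σ₉ ≫ q)) ∧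
            (𝓐.comap j₉ = vanishingIdeal (⟨closure (closure (υ ⁻¹' (A \ {((vanishingIdeal (⟨closure T₁, isClosed_closure⟩ : Closeds F₁)).subschemeι x : F₁)}))), isClosed_closure⟩ : Closeds F₂) ∧ (∀ z : X₉, (stalkIdeal 𝓐 z).IsPrincipal) ∧ Scheme.IsRegular 𝓐.subscheme ∧ σ₉ '' (𝓐.support : Set X₉) ⊆ {y : ↥P | ¬ IsGenericPoint y Y} ∧ Flat (𝓐.subschemeι ≫ σ₉ ≫ q)) ∧
            (𝓒.comap j₉ = vanishingIdeal (⟨closure (closure (υ ⁻¹' (C \ {((vanishingIdeal (⟨closure T₁, isClosed_closure⟩ : Closeds F₁)).subschemeι x : F₁)}))), isClosed_closure⟩ : Closeds F₂) ∧ (∀ z : X₉, (stalkIdeal 𝓒 z).IsPrincipal) ∧ Scheme.IsRegular 𝓒.subscheme ∧ σ₉ '' (𝓒.support : Set X₉) ⊆ {y : ↥P | ¬ IsGenericPoint y Y} ∧ Flat (𝓒.subschemeι ≫ σ₉ ≫ q)) ∧ 𝓚 ≤ 𝓐 ⊔ 𝓒))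

/-- HOPEN(`Open`): the CERTIFIED-OPENING supplier at the initial stage — ✓ K5⁸ :141–:168 verbatim. [folklore; K5⁶/K5⁸] -/
def HOpenSupplier (k : Type) [Field k] (n : ℕ) (H : Scheme.{0}) (ι : H ⟶ (projectiveSpace n k).left)
    (Open : ∀ (F₃ : Scheme.{0}), (F₃ ⟶ (projectiveSpace n k).left) → Set F₃ → List (Set F₃) → Option (Set F₃ × Set F₃ × Set F₃) → Prop) : Prop :=
    ∀ (O : Type) [CommRing O] [IsDomain O] [IsDiscreteValuationRing O] [IsAdicComplete (IsLocalRing.maximalIdeal O) O]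
        [IsAlgClosed (IsLocalRing.ResidueField O)] (θ : O →+* k), Function.Surjective θ → (letI := MvPolynomial.gradedAlgebra (σ := Fin (n + 1)) (R := O);
       letI := MvPolynomial.gradedAlgebra (σ := Fin (n + 1)) (R := k); ∀ (φ : homogeneousSubmodule (Fin (n + 1)) O →+*ᵍ homogeneousSubmodule (Fin (n + 1)) k)
        (hφ' : HomogeneousIdeal.irrelevant (homogeneousSubmodule (Fin (n + 1)) k) ≤ (HomogeneousIdeal.irrelevant (homogeneousSubmodule (Fin (n + 1)) O)).map φ),
        (∀ s, φ s = MvPolynomial.map θ s) → ∀ (Ch : ∀ X' : Scheme.{0}, (X' ⟶ (Proj (homogeneousSubmodule (Fin (n + 1)) O))) → Set X' → Prop),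
        (∀ (X' X'' : Scheme.{0}) (σ' : X' ⟶ (Proj (homogeneousSubmodule (Fin (n + 1)) O))) (S' : Set X') (C : X'.IdealSheafData) (τ : X'' ⟶ X'), Ch X' σ' S' → IsBlowup τ C →
          Scheme.IsRegular C.subscheme → Flat (C.subschemeι ≫ σ' ≫ (Proj.toSpecZero (homogeneousSubmodule (Fin (n + 1)) O) ≫ Spec.map (CommRingCat.ofHom (algebraMap O (homogeneousSubmodule (Fin (n + 1)) O 0))))) →
          σ' '' (C.support : Set X') ⊆ {y | ¬ IsGenericPoint y (Set.range (ι ≫ Proj.map φ hφ' : H ⟶ Proj (homogeneousSubmodule (Fin (n + 1)) O)))} →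
          (C.support : Set X') ∩ (σ' ≫ (Proj.toSpecZero (homogeneousSubmodule (Fin (n + 1)) O) ≫ Spec.map (CommRingCat.ofHom (algebraMap O (homogeneousSubmodule (Fin (n + 1)) O 0))))) ⁻¹' {IsLocalRing.closedPoint O} ⊆ S' →
          Ch X'' (τ ≫ σ') (closure (τ ⁻¹' (S' \ (C.support : Set X'))))) → (∀ (X' : Scheme.{0}) (σ' : X' ⟶ (Proj (homogeneousSubmodule (Fin (n + 1)) O))) (S' : Set X'), Ch X' σ' S' →
          Chain (Proj (homogeneousSubmodule (Fin (n + 1)) O)) (Set.range (ι ≫ Proj.map φ hφ' : H ⟶ Proj (homogeneousSubmodule (Fin (n + 1)) O))) X' σ' S') →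
        (Set.range (ι ≫ Proj.map φ hφ' : H ⟶ Proj (homogeneousSubmodule (Fin (n + 1)) O))) ⊆ (Proj.toSpecZero (homogeneousSubmodule (Fin (n + 1)) O) ≫ Spec.map (CommRingCat.ofHom (algebraMap O (homogeneousSubmodule (Fin (n + 1)) O 0)))) ⁻¹' {IsLocalRing.closedPoint O} → IsIrreducible (Set.range (ι ≫ Proj.map φ hφ' : H ⟶ Proj (homogeneousSubmodule (Fin (n + 1)) O))) → IsClosed (Set.range (ι ≫ Proj.map φ hφ' : H ⟶ Proj (homogeneousSubmodule (Fin (n + 1)) O))) →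
        IsIntegral (Proj (homogeneousSubmodule (Fin (n + 1)) O)) → IsLocallyNoetherian (Proj (homogeneousSubmodule (Fin (n + 1)) O)) → Scheme.IsRegular (Proj (homogeneousSubmodule (Fin (n + 1)) O)) →
        IsProper (Proj.toSpecZero (homogeneousSubmodule (Fin (n + 1)) O) ≫ Spec.map (CommRingCat.ofHom (algebraMap O (homogeneousSubmodule (Fin (n + 1)) O 0)))) → SmoothOfRelativeDimension n (Proj.toSpecZero (homogeneousSubmodule (Fin (n + 1)) O) ≫ Spec.map (CommRingCat.ofHom (algebraMap O (homogeneousSubmodule (Fin (n + 1)) O 0)))) →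
      -- the INITIAL stage `(ℙⁿ_O, 𝟙, Y)` and its model `ℙⁿ_k` (the base model square `Proj.map φ`)
      Ch (Proj (homogeneousSubmodule (Fin (n + 1)) O)) (𝟙 (Proj (homogeneousSubmodule (Fin (n + 1)) O))) (Set.range (ι ≫ Proj.map φ hφ' : H ⟶ Proj (homogeneousSubmodule (Fin (n + 1)) O))) → IsDominant (𝟙 (Proj (homogeneousSubmodule (Fin (n + 1)) O)) ≫ (Proj.toSpecZero (homogeneousSubmodule (Fin (n + 1)) O) ≫ Spec.map (CommRingCat.ofHom (algebraMap O (homogeneousSubmodule (Fin (n + 1)) O 0))))) →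
      IsIntegral (projectiveSpace n k).left → ∀ (t : (projectiveSpace n k).left ⟶ Spec (.of k)),
        IsPullback (Proj.map φ hφ' : (projectiveSpace n k).left ⟶ Proj (homogeneousSubmodule (Fin (n + 1)) O)) t (𝟙 (Proj (homogeneousSubmodule (Fin (n + 1)) O)) ≫ (Proj.toSpecZero (homogeneousSubmodule (Fin (n + 1)) O) ≫ Spec.map (CommRingCat.ofHom (algebraMap O (homogeneousSubmodule (Fin (n + 1)) O 0))))) (Spec.map (CommRingCat.ofHom θ)) →
      IsClosed (Set.range ι) → IsIrreducible (Set.range ι) → (Proj.map φ hφ' : (projectiveSpace n k).left ⟶ Proj (homogeneousSubmodule (Fin (n + 1)) O)) '' Set.range ι = (Set.range (ι ≫ Proj.map φ hφ' : H ⟶ Proj (homogeneousSubmodule (Fin (n + 1)) O))) →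
      ∀ (F₃ : Scheme.{0}) (ρ₃ : F₃ ⟶ (projectiveSpace n k).left) (T₃ : Set F₃) (Ls₃ : List (Set F₃)) (Kp₃ : Option (Set F₃ × Set F₃ × Set F₃)), Open F₃ ρ₃ T₃ Ls₃ Kp₃ →
        ∃ (X₉ : Scheme.{0}) (σ₉ : X₉ ⟶ (Proj (homogeneousSubmodule (Fin (n + 1)) O))) (S₉ : Set X₉) (j₉ : F₃ ⟶ X₉) (t₉ : F₃ ⟶ Spec (.of k)), Ch X₉ σ₉ S₉ ∧ IsIntegral X₉ ∧ IsLocallyNoetherian X₉ ∧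
          Scheme.IsRegular X₉ ∧ IsDominant (σ₉ ≫ (Proj.toSpecZero (homogeneousSubmodule (Fin (n + 1)) O) ≫ Spec.map (CommRingCat.ofHom (algebraMap O (homogeneousSubmodule (Fin (n + 1)) O 0))))) ∧
          IsPullback j₉ t₉ (σ₉ ≫ (Proj.toSpecZero (homogeneousSubmodule (Fin (n + 1)) O) ≫ Spec.map (CommRingCat.ofHom (algebraMap O (homogeneousSubmodule (Fin (n + 1)) O 0))))) (Spec.map (CommRingCat.ofHom θ)) ∧ j₉ '' T₃ = S₉ ∧
          IsClosed T₃ ∧ IsIrreducible T₃ ∧ IsIntegral F₃ ∧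
          (∀ L ∈ Ls₃, TCPlus.LetterDatum O (Proj (homogeneousSubmodule (Fin (n + 1)) O)) (Proj.toSpecZero (homogeneousSubmodule (Fin (n + 1)) O) ≫ Spec.map (CommRingCat.ofHom (algebraMap O (homogeneousSubmodule (Fin (n + 1)) O 0)))) (Set.range (ι ≫ Proj.map φ hφ' : H ⟶ Proj (homogeneousSubmodule (Fin (n + 1)) O))) F₃ X₉ σ₉ j₉ L) ∧
          (∀ K A C : Set F₃, Kp₃ = some (K, A, C) → (∃ (𝓚 𝓐 𝓒 : X₉.IdealSheafData), (𝓚.comap j₉ = vanishingIdeal (⟨closure K, isClosed_closure⟩ : Closeds F₃) ∧ (∀ z : X₉, (stalkIdeal 𝓚 z).IsPrincipal) ∧ Scheme.IsRegular 𝓚.subscheme ∧ σ₉ '' (𝓚.support : Set X₉) ⊆ {y : ↥(Proj (homogeneousSubmodule (Fin (n + 1)) O)) | ¬ IsGenericPoint y (Set.range (ι ≫ Proj.map φ hφ' : H ⟶ Proj (homogeneousSubmodule (Fin (n + 1)) O)))} ∧ Flat (𝓚.subschemeι ≫ σ₉ ≫ (Proj.toSpecZero (homogeneousSubmodule (Fin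 (n + 1)) O) ≫ Spec.map (CommRingCat.ofHom (algebraMap O (homogeneousSubmodule (Fin (n + 1)) O 0)))))) ∧
            (𝓐.comap j₉ = vanishingIdeal (⟨closure A, isClosed_closure⟩ : Closeds F₃) ∧ (∀ z : X₉, (stalkIdeal 𝓐 z).IsPrincipal) ∧ Scheme.IsRegular 𝓐.subscheme ∧ σ₉ '' (𝓐.support : Set X₉) ⊆ {y : ↥(Proj (homogeneousSubmodule (Fin (n + 1)) O)) | ¬ IsGenericPoint y (Set.range (ι ≫ Proj.map φ hφ' : H ⟶ Proj (homogeneousSubmodule (Fin (n + 1)) O)))} ∧ Flat (𝓐.subschemeι ≫ σ₉ ≫ (Proj.toSpecZero (homogeneousSubmodule (Fin (n + 1)) O) ≫ Spec.map (CommRingCat.ofHom (algebraMap O (homogeneousSubmodule (Fin (n + 1)) O 0)))))) ∧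
            (𝓒.comap j₉ = vanishingIdeal (⟨closure C, isClosed_closure⟩ : Closeds F₃) ∧ (∀ z : X₉, (stalkIdeal 𝓒 z).IsPrincipal) ∧ Scheme.IsRegular 𝓒.subscheme ∧ σ₉ '' (𝓒.support : Set X₉) ⊆ {y : ↥(Proj (homogeneousSubmodule (Fin (n + 1)) O)) | ¬ IsGenericPoint y (Set.range (ι ≫ Proj.map φ hφ' : H ⟶ Proj (homogeneousSubmodule (Fin (n + 1)) O)))} ∧ Flat (𝓒.subschemeι ≫ σ₉ ≫ (Proj.toSpecZero (homogeneousSubmodule (Fin (n + 1)) O) ≫ Spec.map (CommRingCat.ofHom (algebraMap O (homogeneousSubmodule (Fin (n + 1)) O 0)))))) ∧ 𝓚 ≤ 𝓐 ⊔ 𝓒)))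

/-- HPAIR: the PAIR-ROUND supplier (centre `𝓐 ⊔ 𝓑` of two listed letters crossing transversally along `Z`) — ✓ K5⁸ :171–:190 verbatim. [folklore; K5⁶/K5⁸] -/
def HPairSupplier (k : Type) [Field k] (n : ℕ) : Prop :=
  ∀ (O : Type) [CommRing O] [IsDomain O] [IsDiscreteValuationRing O] [IsAdicComplete (IsLocalRing.maximalIdeal O) O] [IsAlgClosed (IsLocalRing.ResidueField O)] (θ : O →+* k), Function.Surjective θ →
      ∀ (P : Scheme.{0}) (q : P ⟶ Spec (.of O)) (Y : Set P) (Ch : ∀ X' : Scheme.{0}, (X' ⟶ P) → Set X' → Prop), (∀ (X' X'' : Scheme.{0}) (σ' : X' ⟶ P) (S' : Set X') (C : X'.IdealSheafData) (τ : X'' ⟶ X'), Ch X' σ' S' → IsBlowup τ C →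
          Scheme.IsRegular C.subscheme → Flat (C.subschemeι ≫ σ' ≫ q) → σ' '' (C.support : Set X') ⊆ {y | ¬ IsGenericPoint y Y} → (C.support : Set X') ∩ (σ' ≫ q) ⁻¹' {IsLocalRing.closedPoint O} ⊆ S' →
          Ch X'' (τ ≫ σ') (closure (τ ⁻¹' (S' \ (C.support : Set X'))))) → (∀ (X' : Scheme.{0}) (σ' : X' ⟶ P) (S' : Set X'), Ch X' σ' S' → Chain P Y X' σ' S') → Y ⊆ q ⁻¹' {IsLocalRing.closedPoint O} → IsIrreducible Y → IsClosed Y →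
        IsIntegral P → IsLocallyNoetherian P → Scheme.IsRegular P → IsProper q → SmoothOfRelativeDimension n q →
      -- the stage and its model
      ∀ (X' : Scheme.{0}) (σ' : X' ⟶ P) (S' : Set X'), Ch X' σ' S' → IsIntegral X' → IsLocallyNoetherian X' → Scheme.IsRegular X' → IsDominant (σ' ≫ q) → ∀ (F₁ : Scheme.{0}), IsIntegral F₁ → ∀ (j : F₁ ⟶ X') (t : F₁ ⟶ Spec (.of k)),
        IsPullback j t (σ' ≫ q) (Spec.map (CommRingCat.ofHom θ)) → ∀ (T₁ : Set F₁), IsClosed T₁ → IsIrreducible T₁ → j '' T₁ = S' → ∀ (Ls : List (Set F₁)) (Kp : Option (Set F₁ × Set F₁ × Set F₁)), (∀ L ∈ Ls, TCPlus.LetterDatum O P q Y F₁ X' σ' j L) →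
        (∀ K A C : Set F₁, Kp = some (K, A, C) → (∃ (𝓚 𝓐 𝓒 : X'.IdealSheafData), (𝓚.comap j = vanishingIdeal (⟨closure K, isClosed_closure⟩ : Closeds F₁) ∧ (∀ z : X', (stalkIdeal 𝓚 z).IsPrincipal) ∧ Scheme.IsRegular 𝓚.subscheme ∧ σ' '' (𝓚.support : Set X') ⊆ {y : ↥P | ¬ IsGenericPoint y Y} ∧ Flat (𝓚.subschemeι ≫ σ' ≫ q)) ∧
            (𝓐.comap j = vanishingIdeal (⟨closure A, isClosed_closure⟩ : Closeds F₁) ∧ (∀ z : X', (stalkIdeal 𝓐 z).IsPrincipal) ∧ Scheme.IsRegular 𝓐.subscheme ∧ σ' '' (𝓐.support : Set X') ⊆ {y : ↥P | ¬ IsGenericPoint y Y} ∧ Flat (𝓐.subschemeι ≫ σ' ≫ q)) ∧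
            (𝓒.comap j = vanishingIdeal (⟨closure C, isClosed_closure⟩ : Closeds F₁) ∧ (∀ z : X', (stalkIdeal 𝓒 z).IsPrincipal) ∧ Scheme.IsRegular 𝓒.subscheme ∧ σ' '' (𝓒.support : Set X') ⊆ {y : ↥P | ¬ IsGenericPoint y Y} ∧ Flat (𝓒.subschemeι ≫ σ' ≫ q)) ∧ 𝓚 ≤ 𝓐 ⊔ 𝓒)) →
      ∀ (A B Z : Set F₁) (hZ : IsClosed Z), A ∈ Ls → B ∈ Ls → A ≠ B → vanishingIdeal (⟨closure A, isClosed_closure⟩ : Closeds F₁) ⊔ vanishingIdeal (⟨closure B, isClosed_closure⟩ : Closeds F₁) = vanishingIdeal (⟨Z, hZ⟩ : Closeds F₁) →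
        Z ⊆ T₁ → ¬ T₁ ⊆ Z → (∀ z : ↥(redSub F₁ Z hZ), IsRegularLocalRing ((redSub F₁ Z hZ).presheaf.stalk z)) →
        (∀ z : ↥(redSub F₁ Z hZ), IsClosed ({z} : Set ↥(redSub F₁ Z hZ)) → ringKrullDim ((redSub F₁ Z hZ).presheaf.stalk z) = ((1 : ℕ) : WithBot ℕ∞)) → (∀ z ∈ Z, IsClosed ({z} : Set F₁) → IsRegularLocalRing (F₁.presheaf.stalk z)) →
        (∀ K A' C' : Set F₁, Kp = some (K, A', C') → K ∈ Ls ∧ K ≠ A ∧ K ≠ B ∧ ((A' = A ∧ C' = B) ∨ (A' = B ∧ C' = A))) → (∀ L ∈ Ls, L ≠ A → L ≠ B → (∀ K A' C' : Set F₁, Kp = some (K, A', C') → L ≠ K) →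
          vanishingIdeal (⟨closure L, isClosed_closure⟩ : Closeds F₁) ⊔ vanishingIdeal (⟨Z, hZ⟩ : Closeds F₁) = vanishingIdeal (⟨closure L ∩ Z, isClosed_closure.inter hZ⟩ : Closeds F₁) ∧ ∀ z ∈ Z, IsClosed ({z} : Set F₁) →
            ¬ stalkIdeal (vanishingIdeal (⟨closure L, isClosed_closure⟩ : Closeds F₁)) z ≤ stalkIdeal (vanishingIdeal (⟨Z, hZ⟩ : Closeds F₁)) z) → ∀ (F₃ : Scheme.{0}) (υ' : F₃ ⟶ F₁), IsBlowup υ' (vanishingIdeal (⟨Z, hZ⟩ : Closeds F₁)) →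
        ∃ (X₉ : Scheme.{0}) (σ₉ : X₉ ⟶ P) (S₉ : Set X₉) (j₉ : F₃ ⟶ X₉) (t₉ : F₃ ⟶ Spec (.of k)), Ch X₉ σ₉ S₉ ∧ IsIntegral X₉ ∧ IsLocallyNoetherian X₉ ∧ Scheme.IsRegular X₉ ∧ IsDominant (σ₉ ≫ q) ∧
          IsPullback j₉ t₉ (σ₉ ≫ q) (Spec.map (CommRingCat.ofHom θ)) ∧ j₉ '' (closure (υ' ⁻¹' (T₁ \ Z))) = S₉ ∧ IsClosed (closure (υ' ⁻¹' (T₁ \ Z))) ∧ IsIrreducible (closure (υ' ⁻¹' (T₁ \ Z))) ∧ IsIntegral F₃ ∧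
          (∀ L ∈ Ls, TCPlus.LetterDatum O P q Y F₃ X₉ σ₉ j₉ (closure (υ' ⁻¹' (closure L \ Z)))) ∧ TCPlus.LetterDatum O P q Y F₃ X₉ σ₉ j₉ (υ' ⁻¹' Z)

/-- HROUND-KEEP-N: the STAGE-LEVEL NODAL HOSTED ROUND supplier that keeps its members ((N1)–(N4)) — ✓ K5⁸ :194–:248 verbatim. [folklore; K5⁸ / `TCPlus.hround_keep`] -/
def HRoundKeepNSupplier (k : Type) [Field k] (n : ℕ) : Prop :=
    ∀ (O : Type) [CommRing O] [IsDomain O] [IsDiscreteValuationRing O] [IsAdicComplete (IsLocalRing.maximalIdeal O) O]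
        [IsAlgClosed (IsLocalRing.ResidueField O)] (θ : O →+* k), Function.Surjective θ →
      ∀ (P : Scheme.{0}) (q : P ⟶ Spec (.of O)) (Y : Set P)
        (Ch : ∀ X' : Scheme.{0}, (X' ⟶ P) → Set X' → Prop),
        (∀ (X' X'' : Scheme.{0}) (σ' : X' ⟶ P) (S' : Set X') (C : X'.IdealSheafData) (τ : X'' ⟶ X'),
          Ch X' σ' S' → IsBlowup τ C →
          Scheme.IsRegular C.subscheme → Flat (C.subschemeι ≫ σ' ≫ q) →
          σ' '' (C.support : Set X') ⊆ {y | ¬ IsGenericPoint y Y} →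
          (C.support : Set X') ∩ (σ' ≫ q) ⁻¹' {IsLocalRing.closedPoint O} ⊆ S' →
          Ch X'' (τ ≫ σ') (closure (τ ⁻¹' (S' \ (C.support : Set X'))))) →
        (∀ (X' : Scheme.{0}) (σ' : X' ⟶ P) (S' : Set X'), Ch X' σ' S' →
          Chain P Y X' σ' S') →
        Y ⊆ q ⁻¹' {IsLocalRing.closedPoint O} → IsIrreducible Y → IsClosed Y →
        IsIntegral P → IsLocallyNoetherian P → Scheme.IsRegular P →
        IsProper q → SmoothOfRelativeDimension n q →
      ∀ (X' : Scheme.{0}) (σ' : X' ⟶ P) (S' : Set X'), Ch X' σ' S' → IsIntegral X' →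
        IsLocallyNoetherian X' → Scheme.IsRegular X' →
        IsDominant (σ' ≫ q) →
      ∀ (F₁ : Scheme.{0}), IsIntegral F₁ → ∀ (j : F₁ ⟶ X')
        (t : F₁ ⟶ Spec (.of k)),
        IsPullback j t (σ' ≫ q) (Spec.map (CommRingCat.ofHom θ)) →
      ∀ (T₁ : Set F₁), IsClosed T₁ → IsIrreducible T₁ → j '' T₁ = S' →
      ∀ (Ls : List (Set F₁)), (∀ L ∈ Ls, TCPlus.LetterDatum O P q Y F₁ X' σ' j L) →
      ∀ (E₁ : Set F₁) (Z : Set F₁) (hZ : IsClosed Z) (F₃ : Scheme.{0}) (υ' : F₃ ⟶ F₁),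
        E₁ ∈ Ls → Z ⊆ closure E₁ → Z ⊆ T₁ → ¬ T₁ ⊆ Z →
        Set.Finite {z : ↥(redSub F₁ Z hZ) | ¬ IsRegularLocalRing ((redSub F₁ Z hZ).presheaf.stalk z)} →
        (∀ (i : redSub F₁ Z hZ ⟶ redSub F₁ (closure E₁) isClosed_closure), i ≫ redSubι F₁ (closure E₁) isClosed_closure = redSubι F₁ Z hZ →
          ∀ z : ↥(redSub F₁ Z hZ), IsRegularLocalRing ((redSub F₁ (closure E₁) isClosed_closure).presheaf.stalk (i z))) →
        DirStepUnobs F₁ (closure E₁) isClosed_closure Z hZ →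
        (∀ (i : redSub F₁ Z hZ ⟶ redSub F₁ (closure E₁) isClosed_closure), i ≫ redSubι F₁ (closure E₁) isClosed_closure = redSubι F₁ Z hZ →
          ∃ ψ : Γ(Literature.AlgebraicGeometry.HodgeTheory.normalSheaf i, ⊤),
            ∀ z : ↥(redSub F₁ Z hZ), IsClosed ({z} : Set ↥(redSub F₁ Z hZ)) → ¬ IsRegularLocalRing ((redSub F₁ Z hZ).presheaf.stalk z) →
              ∃ (U : (redSub F₁ (closure E₁) isClosed_closure).affineOpens) (hz : z ∈ i ⁻¹ᵁ (U : (redSub F₁ (closure E₁) isClosed_closure).Opens))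
                (m : Γ(Literature.AlgebraicGeometry.Deformation.idealModule i, (U : (redSub F₁ (closure E₁) isClosed_closure).Opens))),
                IsUnit ((redSub F₁ Z hZ).presheaf.germ (i ⁻¹ᵁ (U : (redSub F₁ (closure E₁) isClosed_closure).Opens)) z hz
                  (Literature.AlgebraicGeometry.HodgeTheory.normalSectionsVal i U
                    (Literature.AlgebraicGeometry.HodgeTheory.normalSheafSectionsEquiv i _
                      ((Literature.AlgebraicGeometry.HodgeTheory.normalSheaf i).presheaf.map (homOfLE le_top).op ψ)) m))) →
        (∀ z : ↥(redSub F₁ Z hZ), IsClosed ({z} : Set ↥(redSub F₁ Z hZ)) → ringKrullDim ((redSub F₁ Z hZ).presheaf.stalk z) = ((1 : ℕ) : WithBot ℕ∞)) →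
        -- the pair clause's «other members» block: every listed `L ≠ E₁` does not contain `Z` and meets it transversally (possibly not at all)
        (∀ L ∈ Ls, L ≠ E₁ →
          vanishingIdeal (⟨closure L, isClosed_closure⟩ : Closeds F₁) ⊔
              vanishingIdeal (⟨Z, hZ⟩ : Closeds F₁) =
            vanishingIdeal (⟨closure L ∩ Z, isClosed_closure.inter hZ⟩ : Closeds F₁) ∧
          ∀ z ∈ Z, IsClosed ({z} : Set F₁) →
            ¬ stalkIdeal (vanishingIdeal (⟨closure L, isClosed_closure⟩ : Closeds F₁)) z ≤
              stalkIdeal (vanishingIdeal (⟨Z, hZ⟩ : Closeds F₁)) z) →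
        IsBlowup υ' (vanishingIdeal (⟨Z, hZ⟩ : Closeds F₁)) →
        ∃ (X₉ : Scheme.{0}) (σ₉ : X₉ ⟶ P) (S₉ : Set X₉) (j₉ : F₃ ⟶ X₉) (t₉ : F₃ ⟶ Spec (.of k)),
          Ch X₉ σ₉ S₉ ∧ IsIntegral X₉ ∧ IsLocallyNoetherian X₉ ∧
          Scheme.IsRegular X₉ ∧ IsDominant (σ₉ ≫ q) ∧
          IsPullback j₉ t₉ (σ₉ ≫ q) (Spec.map (CommRingCat.ofHom θ)) ∧ j₉ '' (closure (υ' ⁻¹' (T₁ \ Z))) = S₉ ∧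
          IsClosed (closure (υ' ⁻¹' (T₁ \ Z))) ∧ IsIrreducible (closure (υ' ⁻¹' (T₁ \ Z))) ∧ IsIntegral F₃ ∧
          (∀ L ∈ Ls, TCPlus.LetterDatum O P q Y F₃ X₉ σ₉ j₉ (closure (υ' ⁻¹' (closure L \ Z)))) ∧
          TCPlus.LetterDatum O P q Y F₃ X₉ σ₉ j₉ (υ' ⁻¹' Z)

/-- HROUND-SEC (W₂ «SECTION ROUND», desk R73/R73a): `HRoundKeepNSupplier`'s text with (N2) «`Ẽ₁` regular along `Z̃`» REPLACED by (L2) «`𝓘(Z)_z = 𝓘(Ē₁)_z + (f)`, `f ∉ 𝓘(Ē₁)_z + 𝔪_z²` at every closed `z ∈ Z`» and (N4) DELETED; same output.  The round centre upstairs is the flat lift of the Cartier-by-one-parameter divisor `Z ⊂ Ē₁` (regular by (u2)). [folklore; W2-SECTION-ROUND memo (idea-3 g16), R73a] -/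
def HRoundSecSupplier (k : Type) [Field k] (n : ℕ) : Prop :=
    ∀ (O : Type) [CommRing O] [IsDomain O] [IsDiscreteValuationRing O] [IsAdicComplete (IsLocalRing.maximalIdeal O) O]
        [IsAlgClosed (IsLocalRing.ResidueField O)] (θ : O →+* k), Function.Surjective θ →
      ∀ (P : Scheme.{0}) (q : P ⟶ Spec (.of O)) (Y : Set P)
        (Ch : ∀ X' : Scheme.{0}, (X' ⟶ P) → Set X' → Prop),
        (∀ (X' X'' : Scheme.{0}) (σ' : X' ⟶ P) (S' : Set X') (C : X'.IdealSheafData) (τ : X'' ⟶ X'),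
          Ch X' σ' S' → IsBlowup τ C →
          Scheme.IsRegular C.subscheme → Flat (C.subschemeι ≫ σ' ≫ q) →
          σ' '' (C.support : Set X') ⊆ {y | ¬ IsGenericPoint y Y} →
          (C.support : Set X') ∩ (σ' ≫ q) ⁻¹' {IsLocalRing.closedPoint O} ⊆ S' →
          Ch X'' (τ ≫ σ') (closure (τ ⁻¹' (S' \ (C.support : Set X'))))) →
        (∀ (X' : Scheme.{0}) (σ' : X' ⟶ P) (S' : Set X'), Ch X' σ' S' →
          Chain P Y X' σ' S') →
        Y ⊆ q ⁻¹' {IsLocalRing.closedPoint O} → IsIrreducible Y → IsClosed Y →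
        IsIntegral P → IsLocallyNoetherian P → Scheme.IsRegular P →
        IsProper q → SmoothOfRelativeDimension n q →
      ∀ (X' : Scheme.{0}) (σ' : X' ⟶ P) (S' : Set X'), Ch X' σ' S' → IsIntegral X' →
        IsLocallyNoetherian X' → Scheme.IsRegular X' →
        IsDominant (σ' ≫ q) →
      ∀ (F₁ : Scheme.{0}), IsIntegral F₁ → ∀ (j : F₁ ⟶ X')
        (t : F₁ ⟶ Spec (.of k)),
        IsPullback j t (σ' ≫ q) (Spec.map (CommRingCat.ofHom θ)) →
      ∀ (T₁ : Set F₁), IsClosed T₁ → IsIrreducible T₁ → j '' T₁ = S' →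
      ∀ (Ls : List (Set F₁)), (∀ L ∈ Ls, TCPlus.LetterDatum O P q Y F₁ X' σ' j L) →
      ∀ (E₁ : Set F₁) (Z : Set F₁) (hZ : IsClosed Z) (F₃ : Scheme.{0}) (υ' : F₃ ⟶ F₁),
        E₁ ∈ Ls → Z ⊆ closure E₁ → Z ⊆ T₁ → ¬ T₁ ⊆ Z →
        Set.Finite {z : ↥(redSub F₁ Z hZ) | ¬ IsRegularLocalRing ((redSub F₁ Z hZ).presheaf.stalk z)} →
        (∀ z ∈ Z, IsClosed ({z} : Set F₁) → ∃ f : F₁.presheaf.stalk z,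
          stalkIdeal (vanishingIdeal (⟨Z, hZ⟩ : Closeds F₁)) z =
              stalkIdeal (vanishingIdeal (⟨closure E₁, isClosed_closure⟩ : Closeds F₁)) z ⊔ Ideal.span {f} ∧
            f ∉ stalkIdeal (vanishingIdeal (⟨closure E₁, isClosed_closure⟩ : Closeds F₁)) z ⊔
              (IsLocalRing.maximalIdeal (F₁.presheaf.stalk z)) ^ 2) →
        DirStepUnobs F₁ (closure E₁) isClosed_closure Z hZ →
        (∀ z : ↥(redSub F₁ Z hZ), IsClosed ({z} : Set ↥(redSub F₁ Z hZ)) → ringKrullDim ((redSub F₁ Z hZ).presheaf.stalk z) = ((1 : ℕ) : WithBot ℕ∞)) →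
        -- the pair clause's «other members» block: every listed `L ≠ E₁` does not contain `Z` and meets it transversally (possibly not at all)
        (∀ L ∈ Ls, L ≠ E₁ →
          vanishingIdeal (⟨closure L, isClosed_closure⟩ : Closeds F₁) ⊔
              vanishingIdeal (⟨Z, hZ⟩ : Closeds F₁) =
            vanishingIdeal (⟨closure L ∩ Z, isClosed_closure.inter hZ⟩ : Closeds F₁) ∧
          ∀ z ∈ Z, IsClosed ({z} : Set F₁) →
            ¬ stalkIdeal (vanishingIdeal (⟨closure L, isClosed_closure⟩ : Closeds F₁)) z ≤
              stalkIdeal (vanishingIdeal (⟨Z, hZ⟩ : Closeds F₁)) z) →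
        IsBlowup υ' (vanishingIdeal (⟨Z, hZ⟩ : Closeds F₁)) →
        ∃ (X₉ : Scheme.{0}) (σ₉ : X₉ ⟶ P) (S₉ : Set X₉) (j₉ : F₃ ⟶ X₉) (t₉ : F₃ ⟶ Spec (.of k)),
          Ch X₉ σ₉ S₉ ∧ IsIntegral X₉ ∧ IsLocallyNoetherian X₉ ∧
          Scheme.IsRegular X₉ ∧ IsDominant (σ₉ ≫ q) ∧
          IsPullback j₉ t₉ (σ₉ ≫ q) (Spec.map (CommRingCat.ofHom θ)) ∧ j₉ '' (closure (υ' ⁻¹' (T₁ \ Z))) = S₉ ∧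
          IsClosed (closure (υ' ⁻¹' (T₁ \ Z))) ∧ IsIrreducible (closure (υ' ⁻¹' (T₁ \ Z))) ∧ IsIntegral F₃ ∧
          (∀ L ∈ Ls, TCPlus.LetterDatum O P q Y F₃ X₉ σ₉ j₉ (closure (υ' ⁻¹' (closure L \ Z)))) ∧
          TCPlus.LetterDatum O P q Y F₃ X₉ σ₉ j₉ (υ' ⁻¹' Z)

/-- **HPRAM** (NEW, WIDTH TABLE W₂, desk R73a (ii) «the nose engine's B₄ bullet ported to the ISO prefix engine») — the HOSTLESS RAMIFIED POINT STEP supplier: from an upstairs stage with a model square, the prefix clause (P-ram)'s letters (res-type-027's `PrefixReachKeyLetterParam9` :214–:232: a closed point `y` of `T̃₁` where neither `T̃₁` nor the ambient is regular, an ideal `J` supported at it and generated in the stalk by three cotangent-independent elements of `𝔪`, its blow-up `υ₂`) are matched by a new upstairs stage with a model square for `(F₂, St T₁)`; no letters, no tag.  Inhabited at `n = 3` over ✓ `fatPointStep_model` (`…NatTowerPtRamMember`, res-L1-w45b-stub-4 g11; the curvilinear fat point lifts to a regular `O`-flat multisection). [OURS · named hypothesis shape, no mathematical content of its own] -/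
def HPRamSupplier (k : Type) [Field k] (n : ℕ) : Prop :=
  ∀ (O : Type) [CommRing O] [IsDomain O] [IsDiscreteValuationRing O] [IsAdicComplete (IsLocalRing.maximalIdeal O) O] [IsAlgClosed (IsLocalRing.ResidueField O)] (θ : O →+* k), Function.Surjective θ →
    ∀ (P : Scheme.{0}) (q : P ⟶ Spec (.of O)) (Y : Set P) (Ch : ∀ X' : Scheme.{0}, (X' ⟶ P) → Set X' → Prop), (∀ (X' X'' : Scheme.{0}) (σ' : X' ⟶ P) (S' : Set X') (C : X'.IdealSheafData) (τ : X'' ⟶ X'), Ch X' σ' S' → IsBlowup τ C →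
        Scheme.IsRegular C.subscheme → Flat (C.subschemeι ≫ σ' ≫ q) → σ' '' (C.support : Set X') ⊆ {y | ¬ IsGenericPoint y Y} → (C.support : Set X') ∩ (σ' ≫ q) ⁻¹' {IsLocalRing.closedPoint O} ⊆ S' →
        Ch X'' (τ ≫ σ') (closure (τ ⁻¹' (S' \ (C.support : Set X'))))) → (∀ (X' : Scheme.{0}) (σ' : X' ⟶ P) (S' : Set X'), Ch X' σ' S' → Chain P Y X' σ' S') → Y ⊆ q ⁻¹' {IsLocalRing.closedPoint O} → IsIrreducible Y → IsClosed Y →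
      IsIntegral P → IsLocallyNoetherian P → Scheme.IsRegular P → IsProper q → SmoothOfRelativeDimension n q →
    ∀ (X' : Scheme.{0}) (σ' : X' ⟶ P) (S' : Set X'), Ch X' σ' S' → IsIntegral X' → IsLocallyNoetherian X' → Scheme.IsRegular X' → IsDominant (σ' ≫ q) → ∀ (F₁ : Scheme.{0}), IsIntegral F₁ → ∀ (j : F₁ ⟶ X') (t : F₁ ⟶ Spec (.of k)),
      IsPullback j t (σ' ≫ q) (Spec.map (CommRingCat.ofHom θ)) → ∀ (T₁ : Set F₁), IsClosed T₁ → IsIrreducible T₁ → j '' T₁ = S' →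
    ∀ (y : ↥(redSub F₁ (closure T₁) isClosed_closure)) (J : F₁.IdealSheafData) (F₂ : Scheme.{0}) (υ₂ : F₂ ⟶ F₁),
      ¬ IsRegularLocalRing ((redSub F₁ (closure T₁) isClosed_closure).presheaf.stalk y) →
      ¬ IsRegularLocalRing (F₁.presheaf.stalk (curvePt F₁ T₁ y)) →
      (J.support : Set F₁) = {curvePt F₁ T₁ y} →
      (∃ (ℓ : Fin 3 → F₁.presheaf.stalk (curvePt F₁ T₁ y)) (hℓ : ∀ i, ℓ i ∈ IsLocalRing.maximalIdeal (F₁.presheaf.stalk (curvePt F₁ T₁ y))),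
        stalkIdeal J (curvePt F₁ T₁ y) = Ideal.span (Set.range ℓ) ∧
        LinearIndependent (IsLocalRing.ResidueField (F₁.presheaf.stalk (curvePt F₁ T₁ y)))
          (fun i => (IsLocalRing.maximalIdeal (F₁.presheaf.stalk (curvePt F₁ T₁ y))).toCotangent ⟨ℓ i, hℓ i⟩)) →
      IsBlowup υ₂ J →
      ∃ (X₉ : Scheme.{0}) (σ₉ : X₉ ⟶ P) (S₉ : Set X₉) (j₉ : F₂ ⟶ X₉) (t₉ : F₂ ⟶ Spec (.of k)), Ch X₉ σ₉ S₉ ∧ IsIntegral X₉ ∧ IsLocallyNoetherian X₉ ∧ Scheme.IsRegular X₉ ∧ IsDominant (σ₉ ≫ q) ∧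
        IsPullback j₉ t₉ (σ₉ ≫ q) (Spec.map (CommRingCat.ofHom θ)) ∧ j₉ '' (closure (υ₂ ⁻¹' (T₁ \ {curvePt F₁ T₁ y}))) = S₉ ∧
        IsClosed (closure (υ₂ ⁻¹' (T₁ \ {curvePt F₁ T₁ y}))) ∧ IsIrreducible (closure (υ₂ ⁻¹' (T₁ \ {curvePt F₁ T₁ y}))) ∧ IsIntegral F₂


/-- **HPRAM-Γ** (9th supplier slot; WIDTH TABLE D13 «(P-ram-Γ) / E-ROUND», desk R74b (c)(d); draft rev2 f8a5defe854d7314 pre-cleared by type idea-2 08:40:24Z, inhabited at n = 3 by stub-2 g20's `TCPlus.pRamGamma_step` ⊙p710420) — the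
hostless RAMIFIED POINT STEP + PLANE ROUND supplier: ✓ `HPRamSupplier`'s context and ram letters VERBATIM, the blow-up `υ₂` of `J`, then the plane-round
letters of `TowerPRamGamma` (the chosen `𝓘 ⊇ J.comap υ₂`, support inside `St T₁` and non-empty, (Γ1), (PΓ), (UΓ) = stub-2's licence binder
2c9419fb1d0b4145 with `𝓙 := J.comap υ₂`), the blow-up `υ₃` of `𝓘`; output = a new upstairs stage with a model square for `(F₃, St St T₁)` TWO stages
down; no letters, no tag.  Intended inhabitant at `n = 3`: ✓ `fatPointStep_model` + stub-2's `ERound.eRoundLift` ((Γ2) «host two-dimensional» is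
ENGINE-supplied from the model, never a door letter). [OURS · named hypothesis shape, no mathematical content of its own] -/
def HPRamGammaSupplier (k : Type) [Field k] (n : ℕ) : Prop :=
  ∀ (O : Type) [CommRing O] [IsDomain O] [IsDiscreteValuationRing O] [IsAdicComplete (IsLocalRing.maximalIdeal O) O] [IsAlgClosed (IsLocalRing.ResidueField O)] (θ : O →+* k), Function.Surjective θ →
    ∀ (P : Scheme.{0}) (q : P ⟶ Spec (.of O)) (Y : Set P) (Ch : ∀ X' : Scheme.{0}, (X' ⟶ P) → Set X' → Prop), (∀ (X' X'' : Scheme.{0}) (σ' : X' ⟶ P) (S' : Set X') (C : X'.IdealSheafData) (τ : X'' ⟶ X'), Ch X' σ' S' → IsBlowup τ C →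
        Scheme.IsRegular C.subscheme → Flat (C.subschemeι ≫ σ' ≫ q) → σ' '' (C.support : Set X') ⊆ {y | ¬ IsGenericPoint y Y} → (C.support : Set X') ∩ (σ' ≫ q) ⁻¹' {IsLocalRing.closedPoint O} ⊆ S' →
        Ch X'' (τ ≫ σ') (closure (τ ⁻¹' (S' \ (C.support : Set X'))))) → (∀ (X' : Scheme.{0}) (σ' : X' ⟶ P) (S' : Set X'), Ch X' σ' S' → Chain P Y X' σ' S') → Y ⊆ q ⁻¹' {IsLocalRing.closedPoint O} → IsIrreducible Y → IsClosed Y →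
      IsIntegral P → IsLocallyNoetherian P → Scheme.IsRegular P → IsProper q → SmoothOfRelativeDimension n q →
    ∀ (X' : Scheme.{0}) (σ' : X' ⟶ P) (S' : Set X'), Ch X' σ' S' → IsIntegral X' → IsLocallyNoetherian X' → Scheme.IsRegular X' → IsDominant (σ' ≫ q) → ∀ (F₁ : Scheme.{0}), IsIntegral F₁ → ∀ (j : F₁ ⟶ X') (t : F₁ ⟶ Spec (.of k)),
      IsPullback j t (σ' ≫ q) (Spec.map (CommRingCat.ofHom θ)) → ∀ (T₁ : Set F₁), IsClosed T₁ → IsIrreducible T₁ → j '' T₁ = S' →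
    ∀ (y : ↥(redSub F₁ (closure T₁) isClosed_closure)) (J : F₁.IdealSheafData) (F₂ : Scheme.{0}) (υ₂ : F₂ ⟶ F₁)
      (𝓘 : F₂.IdealSheafData) (F₃ : Scheme.{0}) (υ₃ : F₃ ⟶ F₂),
      ¬ IsRegularLocalRing ((redSub F₁ (closure T₁) isClosed_closure).presheaf.stalk y) →
      ¬ IsRegularLocalRing (F₁.presheaf.stalk (curvePt F₁ T₁ y)) →
      (J.support : Set F₁) = {curvePt F₁ T₁ y} →
      (∃ (ℓ : Fin 3 → F₁.presheaf.stalk (curvePt F₁ T₁ y)) (hℓ : ∀ i, ℓ i ∈ IsLocalRing.maximalIdeal (F₁.presheaf.stalk (curvePt F₁ T₁ y))),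
        stalkIdeal J (curvePt F₁ T₁ y) = Ideal.span (Set.range ℓ) ∧
        LinearIndependent (IsLocalRing.ResidueField (F₁.presheaf.stalk (curvePt F₁ T₁ y)))
          (fun i => (IsLocalRing.maximalIdeal (F₁.presheaf.stalk (curvePt F₁ T₁ y))).toCotangent ⟨ℓ i, hℓ i⟩)) →
      IsBlowup υ₂ J →
      J.comap υ₂ ≤ 𝓘 → (𝓘.support : Set F₂) ⊆ closure (υ₂ ⁻¹' (T₁ \ {curvePt F₁ T₁ y})) → (𝓘.support : Set F₂).Nonempty →
      (∀ z : ↥𝓘.subscheme, IsClosed ({z} : Set ↥𝓘.subscheme) → ringKrullDim (𝓘.subscheme.presheaf.stalk z) = ((1 : ℕ) : WithBot ℕ∞)) →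
      (∀ x ∈ (𝓘.support : Set F₂), IsClosed ({x} : Set F₂) → ∃ f : F₂.presheaf.stalk x,
        stalkIdeal 𝓘 x = stalkIdeal (J.comap υ₂) x ⊔ Ideal.span {f} ∧
          f ∉ stalkIdeal (J.comap υ₂) x ⊔ (IsLocalRing.maximalIdeal (F₂.presheaf.stalk x)) ^ 2) →
      (∀ (i : 𝓘.subscheme ⟶ (J.comap υ₂).subscheme), i ≫ (J.comap υ₂).subschemeι = 𝓘.subschemeι →
        ∃ V : Fin 2 → (𝓘.subscheme).Opens, (∀ l, IsAffineOpen (V l)) ∧ IsAffineOpen (V 0 ⊓ V 1) ∧ ⨆ l, V l = ⊤ ∧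
          Subsingleton (Literature.AlgebraicGeometry.Morphisms.CechMH1 𝓘.subscheme.toSpecΓ (Literature.AlgebraicGeometry.HodgeTheory.normalSheaf i) V)) →
      IsBlowup υ₃ 𝓘 →
      ∃ (X₉ : Scheme.{0}) (σ₉ : X₉ ⟶ P) (S₉ : Set X₉) (j₉ : F₃ ⟶ X₉) (t₉ : F₃ ⟶ Spec (.of k)), Ch X₉ σ₉ S₉ ∧ IsIntegral X₉ ∧ IsLocallyNoetherian X₉ ∧ Scheme.IsRegular X₉ ∧ IsDominant (σ₉ ≫ q) ∧
        IsPullback j₉ t₉ (σ₉ ≫ q) (Spec.map (CommRingCat.ofHom θ)) ∧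
        j₉ '' (closure (υ₃ ⁻¹' (closure (υ₂ ⁻¹' (T₁ \ {curvePt F₁ T₁ y})) \ (𝓘.support : Set F₂)))) = S₉ ∧
        IsClosed (closure (υ₃ ⁻¹' (closure (υ₂ ⁻¹' (T₁ \ {curvePt F₁ T₁ y})) \ (𝓘.support : Set F₂)))) ∧ IsIrreducible (closure (υ₃ ⁻¹' (closure (υ₂ ⁻¹' (T₁ \ {curvePt F₁ T₁ y})) \ (𝓘.support : Set F₂)))) ∧ IsIntegral F₃

end Summit.ResolutionOfSingularities.ResolutionOfSingularities.Cruxes.EquisingularLiftNat.Sections
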